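import Mathlib
import HarnessLib
import Summits.CriticalPhenomena.CardyFormulaZ2.Theses.CardySelfRefinement
import Literature.Probability.LatticeModels.IsoradialPercolation

/-!
# Sketch — first lemmas of the crux ideas for `TrivialSectorRate` (stmt-CriticalPhenomena-10266)

Ideator planner-cruxidea-stmt-CriticalPhenomena-10266-1-0, round 1. Signatures only (no proofs are
claimed); every `theorem` below is `sorry`'d on purpose — the point is that the statements elaborate
over existing declarations.

* `quarterTurn_transfer` — card `far-field-is-a-quarter-turn`: the measure-theoretic core of the
  lever (TV distance of the C₄-average of `P` to a C₄-invariant `Q` is bounded by the TV distance of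
  `P` to ANY sample-dependent quarter-turn of `Q`).
* `FourArmAboveOneAlongPath` — the exponent input of the same card (x₄ > 1 uniformly along the RSW
  path of `M_k`; in print for bond-ℤ²: Garban–Steif Prop. VI.2.2 / Kesten 1987 / BKS 1999 / SS 2010).
* `SixArmGainAlongPath`, `FiveArmUpperAlongPath` — card `six-strands-pay-exponent-free`: the two
  RSW-robust arm inputs that discharge the ≥ 6-strand sector absolutely.
-/

namespace Summit.CriticalPhenomena.CardyFormulaZ2.Cruxes.TrivialSectorRate.Ideas

open scoped BigOperators
open MeasureTheory

/-- Card `far-field-is-a-quarter-turn`, First lemma (pure measure theory, provable now).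
`σ` is a quarter-turn acting on a finite pattern space `α` (`σ ^ 4 = 1`), `Q` a `σ`-invariant
probability vector (the IIC inner law), `P` any probability vector (the inner law given the far
field), `J z j` the probability of turning the IIC sample `z` by `σ ^ j` (a sample-dependent random
quarter-turn), `R` the law of the turned sample. Then
`TV((1/4) Σ_j σ^j_* P, Q) ≤ TV(R, P)`: the C₄-orbit average of `P` is as close to `Q` as `P` is to the
best quarter-turned copy of `Q`. -/
theorem quarterTurn_transfer {α : Type*} [Fintype α] [DecidableEq α] (σ : Equiv.Perm α)
    (hσ : σ ^ 4 = 1) (P Q : α → ℝ) (hP : ∀ a, 0 ≤ P a) (hP1 : ∑ a, P a = 1)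
    (hQ : ∀ a, 0 ≤ Q a) (hQ1 : ∑ a, Q a = 1) (hQσ : ∀ a, Q (σ a) = Q a)
    (J : α → Fin 4 → ℝ) (hJ : ∀ z j, 0 ≤ J z j) (hJ1 : ∀ z, ∑ j, J z j = 1) :
    let R : α → ℝ := fun a => ∑ z, Q z * ∑ j : Fin 4, (if (σ ^ (j : ℕ)) z = a then J z j else 0)
    let Pavg : α → ℝ := fun a => (1 / 4 : ℝ) * ∑ j : Fin 4, P ((σ ^ (j : ℕ)).symm a)
    (1 / 2 : ℝ) * ∑ a, |Pavg a - Q a| ≤ (1 / 2 : ℝ) * ∑ a, |R a - P a| := by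
  sorry

/-- Card `far-field-is-a-quarter-turn`, exponent input: the four-arm probability of the
interpolating model `M_k(γ(s))` decays strictly faster than `(r/R)¹`, uniformly along every RSW
path `γ` (same `let`-chain as the route file; arm events read through the tree's
`RhombicEmbedding.embArmEvent` for the √2-scaled square embedding). For bond-ℤ² (the endpoint
`(0, 1/2)`) this is Garban–Steif, Prop. "upper bound on the four-arm event in ℤ²" (Kesten 1987,
BKS 1999, Schramm–Steif 2010; multi-scale form: appendix of Schramm–Smirnov 2011). -/
def FourArmAboveOneAlongPath : Prop :=
  let ax : ℕ → Literature.Probability.LatticeModels.Site 2 × Fin 2 → Prop :=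
    fun k e => (k : ℤ) ∣ e.1 (if e.2 = 0 then 1 else 0)
  let tb : ℕ → Literature.Probability.LatticeModels.Site 2 × Fin 2 →
      Literature.Probability.LatticeModels.Site 2 := fun k e i => e.1 i / (k : ℤ)
  let opn : ℕ → Set (Literature.Probability.LatticeModels.Site 2 × Fin 2 × Fin 3) →
      Literature.Probability.LatticeModels.Site 2 × Fin 2 → Prop := fun k S e =>
    if ax k e then ((tb k e, e.2, (2 : Fin 3)) ∈ S ∧ (tb k e, e.2, (1 : Fin 3)) ∈ S) ∨
      ((tb k e, e.2, (2 : Fin 3)) ∉ S ∧ (e.1, e.2, (0 : Fin 3)) ∈ S)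
    else (e.1, e.2, (0 : Fin 3)) ∈ S
  let cfg : ℕ → Set (Literature.Probability.LatticeModels.Site 2 × Fin 2 × Fin 3) →
      Literature.Probability.Percolation.BondConfig (Literature.Probability.LatticeModels.Site 2) :=
    fun k S => {e | ∃ (v : Literature.Probability.LatticeModels.Site 2) (d : Fin 2),
      e = s(v, v + (if d = 0 then ![1, 0] else ![0, 1])) ∧ opn k S (v, d)}
  let prm : ℕ → ℝ → ℝ → Literature.Probability.LatticeModels.Site 2 × Fin 2 × Fin 3 → unitInterval :=
    fun k ρ c i => if i.2.2 = 0 then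
        (if ax k (i.1, i.2.1) then Literature.Probability.Percolation.half
          else Set.projIcc (0 : ℝ) 1 zero_le_one c)
      else if i.2.2 = 1 then Literature.Probability.Percolation.half
      else Set.projIcc (0 : ℝ) 1 zero_le_one ρ
  let M : ℕ → ℝ → ℝ → MeasureTheory.Measure
      (Literature.Probability.Percolation.BondConfig (Literature.Probability.LatticeModels.Site 2)) :=
    fun k ρ c => (Literature.Probability.LatticeModels.prodBernoulli (prm k ρ c)).map (cfg k)
  let PathOK : ℕ → (unitInterval → ℝ × ℝ) → Prop := fun k γ =>
    Continuous γ ∧ γ 0 = (1, 0) ∧ γ 1 = (0, 1 / 2) ∧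
      (∀ s, γ s ∈ Set.Icc (0 : ℝ) 1 ×ˢ Set.Icc (0 : ℝ) 1) ∧
      BoundedVariationOn (fun s => (γ s).1) Set.univ ∧
      BoundedVariationOn (fun s => (γ s).2) Set.univ ∧
      ∀ a : ℝ, 0 < a → ∃ c₀ > 0, ∃ n₀ : ℕ, ∀ s,
        Literature.Probability.LatticeModels.BoxCrossingBounds (M k (γ s).1 (γ s).2)
          Literature.Probability.LatticeModels.squareLatticeEmbedding.z a c₀ n₀
  ∀ k : ℕ, k = 2 ∨ k = 3 → ∀ γ : unitInterval → ℝ × ℝ, PathOK k γ →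
    ∃ ε C : ℝ, 0 < ε ∧ ∀ s : unitInterval, ∀ r R : ℕ, 1 ≤ r → r ≤ R →
      (M k (γ s).1 (γ s).2).real
          (Literature.Probability.LatticeModels.squareLatticeEmbedding.embArmEvent
            ![true, false, true, false] r R) ≤ C * ((r : ℝ) / R) ^ (1 + ε)

/-- Card `six-strands-pay-exponent-free`, First lemma (a): one more arm than five costs a power,
uniformly along the RSW path — the polychromatic six-arm probability of `M_k(γ(s))` is at most
`C (r/R)^(2+ε)`. Exponent-free in the sense that `2` is the UNIVERSAL five-arm exponent
(Kesten–Sidoravicius–Zhang 1998; Nolin 2008 Thm. 23) and `ε` is the RSW gain of the sixth arm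
(Reimer/BK on the coin space + arm separation). -/
def SixArmGainAlongPath : Prop :=
  let ax : ℕ → Literature.Probability.LatticeModels.Site 2 × Fin 2 → Prop :=
    fun k e => (k : ℤ) ∣ e.1 (if e.2 = 0 then 1 else 0)
  let tb : ℕ → Literature.Probability.LatticeModels.Site 2 × Fin 2 →
      Literature.Probability.LatticeModels.Site 2 := fun k e i => e.1 i / (k : ℤ)
  let opn : ℕ → Set (Literature.Probability.LatticeModels.Site 2 × Fin 2 × Fin 3) →
      Literature.Probability.LatticeModels.Site 2 × Fin 2 → Prop := fun k S e =>
    if ax k e then ((tb k e, e.2, (2 : Fin 3)) ∈ S ∧ (tb k e, e.2, (1 : Fin 3)) ∈ S) ∨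
      ((tb k e, e.2, (2 : Fin 3)) ∉ S ∧ (e.1, e.2, (0 : Fin 3)) ∈ S)
    else (e.1, e.2, (0 : Fin 3)) ∈ S
  let cfg : ℕ → Set (Literature.Probability.LatticeModels.Site 2 × Fin 2 × Fin 3) →
      Literature.Probability.Percolation.BondConfig (Literature.Probability.LatticeModels.Site 2) :=
    fun k S => {e | ∃ (v : Literature.Probability.LatticeModels.Site 2) (d : Fin 2),
      e = s(v, v + (if d = 0 then ![1, 0] else ![0, 1])) ∧ opn k S (v, d)}
  let prm : ℕ → ℝ → ℝ → Literature.Probability.LatticeModels.Site 2 × Fin 2 × Fin 3 → unitInterval :=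
    fun k ρ c i => if i.2.2 = 0 then
        (if ax k (i.1, i.2.1) then Literature.Probability.Percolation.half
          else Set.projIcc (0 : ℝ) 1 zero_le_one c)
      else if i.2.2 = 1 then Literature.Probability.Percolation.half
      else Set.projIcc (0 : ℝ) 1 zero_le_one ρ
  let M : ℕ → ℝ → ℝ → MeasureTheory.Measure
      (Literature.Probability.Percolation.BondConfig (Literature.Probability.LatticeModels.Site 2)) :=
    fun k ρ c => (Literature.Probability.LatticeModels.prodBernoulli (prm k ρ c)).map (cfg k)
  let PathOK : ℕ → (unitInterval → ℝ × ℝ) → Prop := fun k γ =>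
    Continuous γ ∧ γ 0 = (1, 0) ∧ γ 1 = (0, 1 / 2) ∧
      (∀ s, γ s ∈ Set.Icc (0 : ℝ) 1 ×ˢ Set.Icc (0 : ℝ) 1) ∧
      BoundedVariationOn (fun s => (γ s).1) Set.univ ∧
      BoundedVariationOn (fun s => (γ s).2) Set.univ ∧
      ∀ a : ℝ, 0 < a → ∃ c₀ > 0, ∃ n₀ : ℕ, ∀ s,
        Literature.Probability.LatticeModels.BoxCrossingBounds (M k (γ s).1 (γ s).2)
          Literature.Probability.LatticeModels.squareLatticeEmbedding.z a c₀ n₀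
  ∀ k : ℕ, k = 2 ∨ k = 3 → ∀ γ : unitInterval → ℝ × ℝ, PathOK k γ →
    ∃ ε C : ℝ, 0 < ε ∧ ∀ s : unitInterval, ∀ r R : ℕ, 1 ≤ r → r ≤ R →
      (M k (γ s).1 (γ s).2).real
          (Literature.Probability.LatticeModels.squareLatticeEmbedding.embArmEvent
            ![true, false, true, false, true, false] r R) ≤ C * ((r : ℝ) / R) ^ (2 + ε)

/-- Card `six-strands-pay-exponent-free`, First lemma (b): the universal five-arm UPPER bound along
the path (the half of Kesten–Sidoravicius–Zhang that the discharge uses), uniformly in `s`. -/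
def FiveArmUpperAlongPath : Prop :=
  let ax : ℕ → Literature.Probability.LatticeModels.Site 2 × Fin 2 → Prop :=
    fun k e => (k : ℤ) ∣ e.1 (if e.2 = 0 then 1 else 0)
  let tb : ℕ → Literature.Probability.LatticeModels.Site 2 × Fin 2 →
      Literature.Probability.LatticeModels.Site 2 := fun k e i => e.1 i / (k : ℤ)
  let opn : ℕ → Set (Literature.Probability.LatticeModels.Site 2 × Fin 2 × Fin 3) →
      Literature.Probability.LatticeModels.Site 2 × Fin 2 → Prop := fun k S e =>
    if ax k e then ((tb k e, e.2, (2 : Fin 3)) ∈ S ∧ (tb k e, e.2, (1 : Fin 3)) ∈ S) ∨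
      ((tb k e, e.2, (2 : Fin 3)) ∉ S ∧ (e.1, e.2, (0 : Fin 3)) ∈ S)
    else (e.1, e.2, (0 : Fin 3)) ∈ S
  let cfg : ℕ → Set (Literature.Probability.LatticeModels.Site 2 × Fin 2 × Fin 3) →
      Literature.Probability.Percolation.BondConfig (Literature.Probability.LatticeModels.Site 2) :=
    fun k S => {e | ∃ (v : Literature.Probability.LatticeModels.Site 2) (d : Fin 2),
      e = s(v, v + (if d = 0 then ![1, 0] else ![0, 1])) ∧ opn k S (v, d)}
  let prm : ℕ → ℝ → ℝ → Literature.Probability.LatticeModels.Site 2 × Fin 2 × Fin 3 → unitInterval :=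
    fun k ρ c i => if i.2.2 = 0 then
        (if ax k (i.1, i.2.1) then Literature.Probability.Percolation.half
          else Set.projIcc (0 : ℝ) 1 zero_le_one c)
      else if i.2.2 = 1 then Literature.Probability.Percolation.half
      else Set.projIcc (0 : ℝ) 1 zero_le_one ρ
  let M : ℕ → ℝ → ℝ → MeasureTheory.Measure
      (Literature.Probability.Percolation.BondConfig (Literature.Probability.LatticeModels.Site 2)) :=
    fun k ρ c => (Literature.Probability.LatticeModels.prodBernoulli (prm k ρ c)).map (cfg k)
  let PathOK : ℕ → (unitInterval → ℝ × ℝ) → Prop := fun k γ =>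
    Continuous γ ∧ γ 0 = (1, 0) ∧ γ 1 = (0, 1 / 2) ∧
      (∀ s, γ s ∈ Set.Icc (0 : ℝ) 1 ×ˢ Set.Icc (0 : ℝ) 1) ∧
      BoundedVariationOn (fun s => (γ s).1) Set.univ ∧
      BoundedVariationOn (fun s => (γ s).2) Set.univ ∧
      ∀ a : ℝ, 0 < a → ∃ c₀ > 0, ∃ n₀ : ℕ, ∀ s,
        Literature.Probability.LatticeModels.BoxCrossingBounds (M k (γ s).1 (γ s).2)
          Literature.Probability.LatticeModels.squareLatticeEmbedding.z a c₀ n₀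
  ∀ k : ℕ, k = 2 ∨ k = 3 → ∀ γ : unitInterval → ℝ × ℝ, PathOK k γ →
    ∃ C : ℝ, ∀ s : unitInterval, ∀ r R : ℕ, 1 ≤ r → r ≤ R →
      (M k (γ s).1 (γ s).2).real
          (Literature.Probability.LatticeModels.squareLatticeEmbedding.embArmEvent
            ![true, false, true, false, true] r R) ≤ C * ((r : ℝ) / R) ^ (2 : ℝ)

/-- Sanity: the crux decl is in scope under its route name (so later skeletons can conclude it). -/
example : Prop := Summit.CriticalPhenomena.CardyFormulaZ2.Theses.CardySelfRefinement.TrivialSectorRate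

end Summit.CriticalPhenomena.CardyFormulaZ2.Cruxes.TrivialSectorRate.Ideas
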